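import Literature.AnabelianGeometry.SemiGraphs.PSCRamificationProofs
import Mathlib.Data.Nat.Factors

/-!
# Cyclic coverings of `l`-power degree: [IUTchI] Rmk. 1.2.3 (iii), (v) and [CombGC] Rmk. 1.4.4, proved

Mochizuki, *A combinatorial version of the Grothendieck conjecture*, Tohoku Math. J. **59** (2007)
[CombGC], §1, Remark 1.4.4 (author's manuscript p. 12), and Mochizuki, *Inter-universal Teichmüller
theory I*, Remark 1.2.3 (iii), (v) (pp. 41, 43) — the replacement texts of [CombGC] Remarks 1.4.2
and 1.4.4.  `PSCRamification.lean` types them as the named facts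

* `PSCDatum.CyclicCuspidallyTotallyRamifiedIff` — "if … the covering `G' → G` is cyclic [of degree
  `l ^ k`, `0 < k`], then `G' → G` is cuspidally totally ramified if and only if the inequality
  `r(G'') < l · r(G)` — where … `G'' → G` is of degree `l` — is satisfied" ([IUTchI] p. 41);
* `PSCDatum.ModulewiseNodalIffNodallyTotallyRamified` — "`G' → G` [cyclic, `G` noncuspidal] is
  module-wise nodal if and only if it is nodally totally ramified" ([CombGC] p. 12);
* the second conjunct of `PSCDatum.NodalEdgeLikeCharacterization` — "the finite étale covering
  `G' → G''` is nodally totally ramified if and only if it is module-wise nodal" ([IUTchI] p. 43),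
  for `Π_{G''} = A · Π_{G'}`, `A` topologically cyclic, `Π_{G'}` characteristic open of finite index,
  `A ⊄ Π_{G'}`;

and this file PROVES them for every datum `G : PSCDatum Π` — hence the origin-parameter bundles
`CyclicCuspidallyTotallyRamifiedIffHolds Ω` and `ModulewiseNodalRemarkHolds Ω` for EVERY `Ω`.  The
group theory is that of a cyclic group of prime-power order (`PSCCountingLemmas.lean`): the unique
subgroup `M ⊇ H'` of index `l` contains every subgroup that fails to generate modulo `H'`, so "some
`Π_e` generates" is detected by the counts of the degree-`l` intermediate covering, resp. by the
closed subgroup generated by `[Π, Π]` and the edge-like subgroups.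
[cite: Mochizuki2012, IUTchI Rmk 1.2.3(iii),(v) pp.41-43] [cite: MochizukiCombGC2007, Rmk 1.4.4 p.12]

Pure proofs; no definitions; nothing here takes a side on [IUTchIII] Cor. 3.12.
-/

noncomputable section

namespace Literature.AnabelianGeometry.SemiGraphs

namespace PSCDatum

open scoped Pointwise commutatorElement

universe u

variable {P : Type u} [Group P] [TopologicalSpace P]

/-! ### Two normality lemmas -/

section Normal

/-- A Galois covering of the base `G = G_Π` corresponds to a NORMAL open subgroup.
[cite: MochizukiCombGC2007, Def 1.4(v) p.11] -/
theorem normal_of_isGaloisCovering_top {H' : Subgroup P} (h : IsGaloisCovering ⊤ H') :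
    H'.Normal := by
  obtain ⟨-, -, -, hn⟩ := h
  rw [Subgroup.normal_subgroupOf_iff_le_normalizer le_top] at hn
  exact Subgroup.normalizer_eq_top_iff.mp (top_le_iff.mp hn)

omit [TopologicalSpace P] in
/-- A subgroup containing `[Π, Π]` is normal. [cite: MochizukiCombGC2007, Def 1.1(ii) p.7] -/
theorem normal_of_commutator_le {M : Subgroup P} (h : ⁅(⊤ : Subgroup P), ⊤⁆ ≤ M) : M.Normal :=
  ⟨fun n hn g => by
    have key : ⁅g, n⁆ * n = g * n * g⁻¹ := by
      rw [commutatorElement_def]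
      group
    rw [← key]
    exact M.mul_mem (h (Subgroup.commutator_mem_commutator (Subgroup.mem_top g)
      (Subgroup.mem_top n))) hn⟩

end Normal

variable (G : PSCDatum P) [IsTopologicalGroup P]

/-! ### [IUTchI] Remark 1.2.3 (iii): the cyclic cuspidal criterion -/

section Cyclic

omit [IsTopologicalGroup P] in
/-- **[IUTchI] Remark 1.2.3 (iii)** (p. 41; replacement of [CombGC] Rmk. 1.4.2, first part),
PROVED for every datum: for a cyclic covering `G' → G` of degree `l ^ k`, `0 < k`, `Σ = {l}`,
"`G' → G` is cuspidally totally ramified if and only if `r(G'') < l · r(G)`", `G''` the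
intermediate covering of degree `l`. [cite: Mochizuki2012, IUTchI Rmk 1.2.3(iii) p.41] -/
theorem cyclicCuspidallyTotallyRamifiedIff : G.CyclicCuspidallyTotallyRamifiedIff := by
  intro l k H' hS hk hcyc hidx
  have hl := G.prime_of_sigma_eq hS
  obtain ⟨hGal, g, -, hgen⟩ := hcyc
  haveI hN : H'.Normal := normal_of_isGaloisCovering_top hGal
  -- normal form of the left-hand side
  have hL : G.IsCuspidallyTotallyRamified ⊤ H' ↔ ∃ c, H' ⊔ G.cuspGp c = ⊤ := by
    unfold IsCuspidallyTotallyRamified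
    rw [and_iff_right hGal]
    simp only [top_inf_eq]
    constructor
    · rintro ⟨c, γ, h⟩
      exact ⟨c, by rw [sup_comm]; exact (smul_sup_eq_top_iff γ _ H').mp h⟩
    · rintro ⟨c, h⟩
      exact ⟨c, 1, by rw [one_smul, sup_comm]; exact h⟩
  rw [hL]
  -- the unique intermediate subgroup of index `l`
  obtain ⟨M, hH'M, -, hMtop, hMidx, hfrat⟩ :=
    PSCCounting.exists_frattini_of_cyclic_quotient H' ⊤ hgen hl hk
      (by rw [Subgroup.relIndex_top_right, hidx])
  rw [Subgroup.relIndex_top_right] at hMidx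
  constructor
  · rintro ⟨c, hc⟩ H'' hH'' hidx''
    haveI : H''.FiniteIndex := ⟨by rw [hidx'']; exact hl.ne_zero⟩
    have hone : Nat.card (DoubleCoset.Quotient (H'' : Set P) (G.cuspGp c : Set P)) = 1 :=
      card_doubleCoset_quotient_eq_one hH'' hc
    have hle : ∀ c', Nat.card (DoubleCoset.Quotient (H'' : Set P) (G.cuspGp c' : Set P)) ≤ l :=
      fun c' => hidx'' ▸ card_doubleCoset_quotient_le_index H'' (G.cuspGp c')
    unfold cuspCount
    rw [← Finset.add_sum_erase Finset.univ _ (Finset.mem_univ c), hone]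
    have hrest := Finset.sum_le_card_nsmul (Finset.univ.erase c)
      (fun c' => Nat.card (DoubleCoset.Quotient (H'' : Set P) (G.cuspGp c' : Set P))) l
      fun c' _ => hle c'
    rw [Finset.card_erase_of_mem (Finset.mem_univ c), smul_eq_mul, Finset.card_univ] at hrest
    have hr : 1 ≤ Fintype.card G.graph.C := Fintype.card_pos_iff.mpr ⟨c⟩
    have hX : (Fintype.card G.graph.C - 1) * l + l = l * Fintype.card G.graph.C := by
      zify [hr]
      ring
    have h1 := hl.one_lt
    show 1 + _ < l * Fintype.card G.graph.C
    linarith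
  · intro h
    by_contra hnone
    push Not at hnone
    have hM := h M hH'M hMidx
    haveI : M.Normal := normal_of_commutator_le
      ((PSCCounting.commutator_le_of_sup_zpowers_eq H' ⊤ hgen).trans hH'M)
    have hcM : ∀ c, G.cuspGp c ≤ M := fun c => by
      by_contra hc
      exact hnone c ((hfrat (G.cuspGp c) le_top).mpr hc)
    rw [G.cuspCount_eq_sum_index M, Finset.sum_congr rfl fun c _ => by
      rw [sup_of_le_left (hcM c), hMidx], Finset.sum_const, smul_eq_mul, Finset.card_univ] at hM
    exact absurd hM (by rw [mul_comm]; exact lt_irrefl _)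

/-- **[IUTchI] Remark 1.2.3 (iii) as printed over the origin parameter**:
`CyclicCuspidallyTotallyRamifiedIffHolds Ω` holds for EVERY `Ω` (all three displays hold for every
datum). [cite: Mochizuki2012, IUTchI Rmk 1.2.3(iii) p.41] -/
theorem cyclicCuspidallyTotallyRamifiedIffHolds (Ω : PSCOrigin.{u}) :
    CyclicCuspidallyTotallyRamifiedIffHolds Ω := by
  intro Q _ _ _ G _
  exact ⟨G.cyclicCuspidallyTotallyRamifiedIff, G.verticialPureRamificationCount,
    G.verticialMinusNodalCount⟩

end Cyclic

/-! ### [CombGC] Remark 1.4.4 (first claim): module-wise nodal ⟺ nodally totally ramified -/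

section Modulewise

omit [IsTopologicalGroup P] in
/-- Without cusps there are no cuspidal subgroups. [cite: MochizukiCombGC2007, Def 1.1(i) p.6] -/
theorem not_isCuspidal_of_isNoncuspidal (hG : G.graph.IsNoncuspidal) (B : Subgroup P) :
    ¬ G.IsCuspidal B := by
  haveI : IsEmpty G.graph.C := Fintype.card_eq_zero_iff.mp hG
  rintro ⟨c, -, -⟩
  exact isEmptyElim c

/-- For a cyclic covering `H' ⊴ H''` (`H'' = H' · ⟨g⟩`) with `H'` open and `G` noncuspidal, the
inverse image of `M^cusp_{G''}` dies in `H'` (it is generated by `[Π_{G''}, Π_{G''}]` only).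
[cite: MochizukiCombGC2007, Def 1.1(ii) p.7] -/
theorem cuspFil_le_of_cyclic (hG : G.graph.IsNoncuspidal) {H'' H' : Subgroup P} [H'.Normal]
    (hO : IsOpen (H' : Set P)) {g : P} (hgen : H' ⊔ Subgroup.zpowers g = H'') :
    G.cuspFil H'' ≤ H' := by
  refine Subgroup.topologicalClosure_minimal _
    (sup_le (PSCCounting.commutator_le_of_sup_zpowers_eq H' H'' hgen) (iSup_le fun A => ?_))
    (Subgroup.isClosed_of_isOpen H' hO)
  obtain ⟨A, B, hB, -⟩ := A
  exact absurd hB (G.not_isCuspidal_of_isNoncuspidal hG B)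

/-- **The key equivalence** behind [CombGC] Rmk. 1.4.4 / [IUTchI] Rmk. 1.2.3 (v): for a cyclic
covering `H' ⊴ H'' = H' · ⟨g⟩` of degree `l ^ j`, `0 < j`, `H'` open and normal in `Π_G`, `G`
noncuspidal: `H' · (inverse image of M^edge_{G''}) = H''` iff some nodal subgroup of `Π_{G''}`
surjects onto `H'' / H'` (the unique maximal proper intermediate subgroup is closed and would
otherwise contain `[H'', H'']` and all edge-like subgroups). [cite: MochizukiCombGC2007, Rmk 1.4.4 p.12] -/
theorem sup_edgeFil_eq_iff_of_cyclic (hG : G.graph.IsNoncuspidal) {H'' H' : Subgroup P}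
    [H'.Normal] (hO : IsOpen (H' : Set P)) {g : P} (hgen : H' ⊔ Subgroup.zpowers g = H'')
    {l j : ℕ} (hl : l.Prime) (hj : 0 < j) (hind : H'.relIndex H'' = l ^ j) :
    H' ⊔ G.edgeFil H'' = H'' ↔ ∃ (e : G.graph.N) (γ : ConjAct P), (H'' ⊓ γ • G.nodeGp e) ⊔ H' = H'' := by
  have hH'H'' : H' ≤ H'' := hgen ▸ le_sup_left
  have hO'' : IsOpen (H'' : Set P) := Subgroup.isOpen_mono hH'H'' hO
  have hcomm : ⁅H'', H''⁆ ≤ H' := PSCCounting.commutator_le_of_sup_zpowers_eq H' H'' hgen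
  obtain ⟨M, hH'M, hMH'', hMne, -, hfrat⟩ :=
    PSCCounting.exists_frattini_of_cyclic_quotient H' H'' hgen hl hj hind
  have hMc : IsClosed (M : Set P) := Subgroup.isClosed_of_isOpen M (Subgroup.isOpen_mono hH'M hO)
  constructor
  · intro h
    by_contra hnone
    push Not at hnone
    have hle : G.edgeFil H'' ≤ M := by
      refine Subgroup.topologicalClosure_minimal _
        (sup_le (hcomm.trans hH'M) (iSup_le fun A => ?_)) hMc
      obtain ⟨A, B, hB, rfl⟩ := A
      rcases hB with ⟨e, γ, rfl⟩ | hB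
      · by_contra hAM
        exact hnone e γ (by rw [sup_comm]; exact (hfrat _ inf_le_left).mpr hAM)
      · exact absurd hB (G.not_isCuspidal_of_isNoncuspidal hG B)
    have hle' : H'' ≤ M := by
      rw [← h]
      exact sup_le hH'M hle
    exact hMne (le_antisymm hMH'' hle')
  · rintro ⟨e, γ, h⟩
    have hE : H'' ⊓ γ • G.nodeGp e ≤ G.edgeFil H'' :=
      le_trans (le_sup_of_le_right (le_iSup_of_le
        ⟨H'' ⊓ γ • G.nodeGp e, γ • G.nodeGp e, Or.inl ⟨e, γ, rfl⟩, rfl⟩ le_rfl))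
        (Subgroup.le_topologicalClosure _)
    apply le_antisymm (sup_le hH'H'' (G.edgeFil_le (Subgroup.isClosed_of_isOpen H'' hO'')))
    calc H'' = (H'' ⊓ γ • G.nodeGp e) ⊔ H' := h.symm
      _ ≤ G.edgeFil H'' ⊔ H' := sup_le_sup_right hE H'
      _ = H' ⊔ G.edgeFil H'' := sup_comm _ _

/-- **[CombGC] Remark 1.4.4, first claim** (p. 12; degree a positive power of `l`), PROVED for
every datum: for `G` noncuspidal with `Σ = {l}` and a cyclic covering `G' → G` of degree `l ^ k`,
`0 < k`, "`G' → G` is module-wise nodal if and only if it is nodally totally ramified".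
[cite: MochizukiCombGC2007, Rmk 1.4.4 p.12] -/
theorem modulewiseNodalIffNodallyTotallyRamified : G.ModulewiseNodalIffNodallyTotallyRamified := by
  intro hG l k H' hS hk hcyc hidx
  have hl := G.prime_of_sigma_eq hS
  obtain ⟨hGal, g, hgtop, hgen⟩ := hcyc
  haveI hN : H'.Normal := normal_of_isGaloisCovering_top hGal
  have hO : IsOpen (H' : Set P) := hGal.2.1
  have hkey := G.sup_edgeFil_eq_iff_of_cyclic hG hO hgen hl hk
    (by rw [Subgroup.relIndex_top_right, hidx])
  unfold IsModulewiseNodal IsNodallyTotallyRamified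
  constructor
  · rintro ⟨-, -, -, -, h5⟩
    obtain ⟨e, γ, h⟩ := hkey.mp h5
    exact ⟨hGal, e, γ, h⟩
  · rintro ⟨-, e, γ, h⟩
    exact ⟨le_top, hGal.2.2.2, ⟨g, hgtop, hgen⟩, G.cuspFil_le_of_cyclic hG hO hgen,
      hkey.mpr ⟨e, γ, h⟩⟩

/-- **[CombGC] Remark 1.4.4 (first claim) as printed over the origin parameter**:
`ModulewiseNodalRemarkHolds Ω` holds for EVERY `Ω`. [cite: MochizukiCombGC2007, Rmk 1.4.4 p.12] -/
theorem modulewiseNodalRemarkHolds (Ω : PSCOrigin.{u}) : ModulewiseNodalRemarkHolds Ω := by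
  intro Q _ _ _ G _
  exact G.modulewiseNodalIffNodallyTotallyRamified

end Modulewise

/-! ### [IUTchI] Remark 1.2.3 (v): "`G' → G''` is nodally totally ramified iff module-wise nodal" -/

section NoteFurther

omit [IsTopologicalGroup P] in
/-- In a pro-`{l}` group, an open normal subgroup of finite index has index a power of `l`.
[cite: MochizukiCombGC2007, Def 1.1(ii) p.6] -/
theorem index_eq_pow_of_sigma_eq {l : ℕ} (hS : G.Sigma = {l}) {U : Subgroup P} [hUn : U.Normal]
    (hUo : IsOpen (U : Set P)) [U.FiniteIndex] : ∃ m : ℕ, U.index = l ^ m := by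
  refine ⟨_, Nat.eq_prime_pow_of_unique_prime_dvd Subgroup.FiniteIndex.index_ne_zero
    fun {p} hp hdvd => ?_⟩
  have hmem := G.proSigma.prime_mem { toSubgroup := U, isOpen' := hUo, isNormal' := hUn }
    (show Finite (P ⧸ U) from inferInstance) p hp hdvd
  rw [hS] at hmem
  exact hmem

/-- **[IUTchI] Remark 1.2.3 (v), "note further"** (p. 43), PROVED for every datum in the form
typed as the second conjunct of `NodalEdgeLikeCharacterization`: for `G` noncuspidal of pro-`{l}`
PSC-type, `A = \overline{⟨a⟩}` a closed topologically cyclic subgroup, `U = Π_{G'}` characteristic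
open of finite index with `A ⊄ U`, and `Π_{G''} = A · U`: "the finite étale covering `G' → G''` is
nodally totally ramified if and only if it is module-wise nodal".
[cite: Mochizuki2012, IUTchI Rmk 1.2.3(v) p.43] -/
theorem nodallyTotallyRamified_iff_modulewiseNodal (hG : G.graph.IsNoncuspidal) {l : ℕ}
    (hS : G.Sigma = {l}) :
    ∀ (A U : Subgroup P), IsClosed (A : Set P) →
      (∃ a : P, (Subgroup.zpowers a).topologicalClosure = A) → (A : Set P).Infinite →
      U.Characteristic → IsOpen (U : Set P) → U.FiniteIndex → ¬ A ≤ U →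
      (G.IsNodallyTotallyRamified (A ⊔ U) U ↔ G.IsModulewiseNodal (A ⊔ U) U) := by
  intro A U _ hA _ hU hUo hUf hAU
  have hl := G.prime_of_sigma_eq hS
  haveI : U.Characteristic := hU
  haveI hUn : U.Normal := inferInstance
  obtain ⟨a, rfl⟩ := hA
  have hHo : IsOpen (((Subgroup.zpowers a).topologicalClosure ⊔ U : Subgroup P) : Set P) :=
    Subgroup.isOpen_mono le_sup_right hUo
  -- the covering `G' → G''` is cyclic, generated by `a`
  have hgen : U ⊔ Subgroup.zpowers a = (Subgroup.zpowers a).topologicalClosure ⊔ U := by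
    apply le_antisymm
    · exact sup_le le_sup_right ((Subgroup.le_topologicalClosure _).trans le_sup_left)
    · refine sup_le ?_ le_sup_left
      exact Subgroup.topologicalClosure_minimal _ le_sup_right
        (Subgroup.isClosed_of_isOpen _ (Subgroup.isOpen_mono le_sup_left hUo))
  -- … of degree `l ^ j`, `0 < j`
  obtain ⟨m, hm⟩ := G.index_eq_pow_of_sigma_eq hS hUo
  obtain ⟨j, -, hj⟩ := (Nat.dvd_prime_pow hl).mp (hm ▸
    Subgroup.relIndex_dvd_index_of_le
      (le_sup_right : U ≤ (Subgroup.zpowers a).topologicalClosure ⊔ U))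
  have hjpos : 0 < j := by
    rcases Nat.eq_zero_or_pos j with rfl | h
    · exfalso
      apply hAU
      rw [pow_zero, Subgroup.relIndex_eq_one] at hj
      exact le_sup_left.trans hj
    · exact h
  have hkey := G.sup_edgeFil_eq_iff_of_cyclic hG hUo hgen hl hjpos hj
  have ha : a ∈ (Subgroup.zpowers a).topologicalClosure ⊔ U :=
    Subgroup.mem_sup_left (Subgroup.le_topologicalClosure _ (Subgroup.mem_zpowers a))
  unfold IsNodallyTotallyRamified IsModulewiseNodal IsGaloisCovering
  constructor
  · rintro ⟨-, h⟩
    exact ⟨le_sup_right, inferInstance, ⟨a, ha, hgen⟩, G.cuspFil_le_of_cyclic hG hUo hgen,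
      hkey.mpr h⟩
  · rintro ⟨-, -, -, -, h⟩
    exact ⟨⟨le_sup_right, hUo, hHo, inferInstance⟩, hkey.mp h⟩

end NoteFurther

end PSCDatum

end Literature.AnabelianGeometry.SemiGraphs

end
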